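import Literature.Topology.FourManifolds.FramedLinkTraceBoundary
import HarnessLib

/-!
# Line `sphere_split`, Stub T2 (`stub_traceBoundary`): the boundary of the trace is the surgery
(crux `VerlindeRLinks.VrlSliceRigidity`, item stmt-SmoothPoincare4-16179)

This file states and proves the registered stub `stub_traceBoundary` (signature verbatim from
the lead's skeleton `Cruxes/VrlSliceRigidity/Lines/sphere_split.lean`): if the compact smooth
`4`-manifold with boundary `P` is the trace `X_L = B⁴ ∪_L (2-handles)` of the framed link
`L ⊂ S³` with `n` components (`L.IsTrace P`), then the carrier of every boundary datum `bP` of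
`P` is integral surgery on `L` with its framings (`L.IsSurgery (𝓡 3) bP.carrier`).  It is the
specialisation to `Fin n` of the Literature theorem
`Literature.Topology.FourManifolds.FramedLink.IsTrace.isSurgery_boundary`
(`FramedLinkTraceBoundary.lean`: Kirby 1989, Ch. I §5 "`N³ = ∂M_L` is obtained from `S³` by
surgery on `L`", Lemma 2.1; Gompf–Stipsicz 1999, §5.3), proved there from the realization of
the dotted-circle-free Kirby diagram of `L` by restricting Kosinski's open gluing to the boundary
sphere, where the identification `x ∼ h̄ α(x)` is the Dehn surgery relation `surgeryRel νᵢ`.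

References: R. C. Kirby, *The Topology of 4-Manifolds*, LNM 1374 (1989), Ch. I §2 Lemma 2.1,
§5; R. E. Gompf, A. I. Stipsicz, *4-Manifolds and Kirby Calculus* (1999), §5.3.
-/

noncomputable section

-- the prescribed namespace `Summit.<P>.<Sub>.…` duplicates `SmoothPoincare4` (P = Sub)
set_option linter.dupNamespace false

namespace Summit.SmoothPoincare4.SmoothPoincare4.Theorems.VrlSliceRigidity.SphereSplit

open scoped Manifold ContDiff Topology
open Set Function Literature.Topology.FourManifolds

/-- **Stub T2 of line `sphere_split` — the boundary of the trace is the surgery**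
(`stub_traceBoundary`, registered signature verbatim).  If `P` is a trace of the framed link
`L ⊂ S³` with `n` components (`L.IsTrace P`: `P` is presented by the Kirby diagram of `L`
without dotted circles) then for every boundary datum `bP` of `P` the boundary `3`-manifold
`bP.carrier` is the integral surgery on `L` (`L.IsSurgery (𝓡 3) bP.carrier`): Kirby 1989,
Ch. I §5 (`N³ = ∂M_L`), Lemma 2.1; the Literature theorem
`FramedLink.IsTrace.isSurgery_boundary`. [cite: Kirby1989, Ch. I §5] -/
theorem stub_traceBoundary :
    ∀ (n : ℕ) (L : FramedLink (Fin n)) (P : Type) [TopologicalSpace P] [T2Space P]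
      [SecondCountableTopology P] [ChartedSpace (EuclideanHalfSpace 4) P]
      [IsManifold (𝓡∂ 4) ∞ P] [CompactSpace P] (bP : BoundaryData (𝓡∂ 4) P (𝓡 3)),
      L.IsTrace P → L.IsSurgery (𝓡 3) bP.carrier :=
  fun _ _ _ _ _ _ _ _ _ bP h => h.isSurgery_boundary bP

end Summit.SmoothPoincare4.SmoothPoincare4.Theorems.VrlSliceRigidity.SphereSplit

end
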